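import Literature.NumberTheory.EllipticCurves.CanonicalPAdicHeightParallelogramProofs
import Literature.NumberTheory.EllipticCurves.PadicSigmaUniquenessProofs
import Literature.NumberTheory.EllipticCurves.PadicSigmaExistenceProofs
import Literature.NumberTheory.EllipticCurves.PAdicLFunction

/-!
# BirchSwinnertonDyer / PAdicOrderV2 — crux `PAdicOrderThesisR2` (stmt-0487), line `wieferich-jet`,
# stub `stub_sigmaJet`: the `t³`-jet of the Mazur–Tate sigma function

Registered stub of the lead skeleton `Cruxes/PAdicOrderThesisR2/Lines/wieferich_jet.lean`:
for `E/ℚ` (globally minimal `W`) and a prime `p ≥ 5` of good ordinary reduction, the canonical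
`p`-adic sigma function `σ_p(t) = Σ cₙ tⁿ` of `W ⊗ ℚ_p` (`WeierstrassCurve.padicSigma`, evaluated
by `WeierstrassCurve.padicSigmaEval`) satisfies, for every `t ∈ ℚ_p` with `‖t‖ < 1`,

  `‖σ_p(t) − t − (a₁/2) t²‖ ≤ ‖t‖³`.

Proof (Mazur–Stein–Tate 2006, Thm. 1.3 and Rem. 1.4): the Mazur–Tate pair exists uniquely
(`WeierstrassCurve.mazur_tate_sigma_existsUnique_holds`), so `(padicSigma, padicSigmaConst)` IS a
Mazur–Tate pair (`isMazurTateSigmaPair_padicSigma`); hence `c₀ = 0`, `c₁ = 1`, `2c₂ = a₁`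
(`IsMazurTateSigmaPair.two_mul_coeff_two`, oddness) and `cₙ ∈ ℤ_p` for all `n`. Peeling the first
three terms off the convergent series (`Summable.sum_add_tsum_nat_add`) leaves the tail
`Σ_{n ≥ 3} cₙ tⁿ`, each of whose terms has norm `≤ ‖t‖ⁿ ≤ ‖t‖³`; the ultrametric inequality for
`tsum` (`IsUltrametricDist.norm_tsum_le_of_forall_le_of_nonneg`) finishes. Everything used is
proved in the tree; the stub is unconditional.
-/

-- single-conjunct summit: `Summit.BirchSwinnertonDyer.BirchSwinnertonDyer.…` repeats the name by design
set_option linter.dupNamespace false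

namespace Summit.BirchSwinnertonDyer.BirchSwinnertonDyer.Cruxes.PAdicOrderThesisR2.WieferichJet

open Literature.NumberTheory.EllipticCurves

/-- **`(σ_p, c)` is a Mazur–Tate pair** for `W ⊗ ℚ_p` when `W/ℚ` is globally minimal elliptic and
`p ≥ 5` is good ordinary: the pair chosen in `WeierstrassCurve.padicSigma` /
`WeierstrassCurve.padicSigmaConst` satisfies `IsMazurTateSigmaPair`, because a pair exists
(Mazur–Stein–Tate 2006, Thm. 1.3 = the tree's theorem
`WeierstrassCurve.mazur_tate_sigma_existsUnique_holds`). [cite: MazurSteinTate2006, Thm. 1.3] -/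
theorem isMazurTateSigmaPair_padicSigma_of_isOrdinaryAt (W : WeierstrassCurve ℚ) [W.IsElliptic]
    [W.IsGloballyMinimal] (p : ℕ) [Fact p.Prime] (h5 : 5 ≤ p) (hord : IsOrdinaryAt W p) :
    (W.baseChange ℚ_[p]).IsMazurTateSigmaPair (W.baseChange ℚ_[p]).padicSigma
      (W.baseChange ℚ_[p]).padicSigmaConst := by
  have hMT := WeierstrassCurve.mazur_tate_sigma_existsUnique_holds W p h5 hord.1 hord.2
  refine (W.baseChange ℚ_[p]).isMazurTateSigmaPair_padicSigma ?_
  obtain ⟨σc, hσc, -⟩ := hMT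
  exact ⟨σc.1, σc.2, hσc⟩

/-- **`c₂ = a₁/2`**: the quadratic coefficient of the canonical `p`-adic sigma function of a
globally minimal elliptic `W/ℚ` at a good ordinary prime `p ≥ 5` is `a₁/2`
(`σ_p(t) = t + (a₁/2)t² + ⋯`; Mazur–Stein–Tate 2006, Thm. 1.3 and Rem. 1.4: oddness
`σ(i(t)) = -σ(t)` with `i(t) = -t - a₁t² - ⋯` forces `2c₂ = a₁`, tree theorem
`IsMazurTateSigmaPair.two_mul_coeff_two`). [cite: MazurSteinTate2006, Thm. 1.3] -/
theorem coeff_two_padicSigma_eq (W : WeierstrassCurve ℚ) [W.IsElliptic] [W.IsGloballyMinimal]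
    (p : ℕ) [Fact p.Prime] (h5 : 5 ≤ p) (hord : IsOrdinaryAt W p) :
    PowerSeries.coeff 2 (W.baseChange ℚ_[p]).padicSigma = (W.a₁ : ℚ_[p]) / 2 := by
  have h2 := (isMazurTateSigmaPair_padicSigma_of_isOrdinaryAt W p h5 hord).two_mul_coeff_two
  have ha : (W.baseChange ℚ_[p]).a₁ = (W.a₁ : ℚ_[p]) := by
    simp [WeierstrassCurve.baseChange, WeierstrassCurve.map_a₁]
  rw [ha] at h2
  rw [eq_div_iff two_ne_zero, mul_comm]
  exact h2

/-- **The tail of the sigma series**: for `W/ℚ` globally minimal elliptic, `p ≥ 5` good ordinary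
and `‖t‖ < 1`, `σ_p(t) − t − (a₁/2)t² = Σ_{n ≥ 0} c_{n+3} t^{n+3}` (peel `c₀ = 0`, `c₁ = 1`,
`c₂ = a₁/2` off the convergent series `σ_p(t) = Σ cₙ tⁿ`; Mazur–Stein–Tate 2006, Thm. 1.3).
[cite: MazurSteinTate2006, Thm. 1.3] -/
theorem padicSigmaEval_sub_sub_eq_tsum (W : WeierstrassCurve ℚ) [W.IsElliptic]
    [W.IsGloballyMinimal] (p : ℕ) [Fact p.Prime] (h5 : 5 ≤ p) (hord : IsOrdinaryAt W p)
    (t : ℚ_[p]) (ht : ‖t‖ < 1) :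
    W.padicSigmaEval p t - t - (W.a₁ : ℚ_[p]) / 2 * t ^ 2 =
      ∑' n : ℕ, PowerSeries.coeff (n + 3) (W.baseChange ℚ_[p]).padicSigma * t ^ (n + 3) := by
  have hsum := (W.baseChange ℚ_[p]).summable_padicSigma ht
  have hc2 := coeff_two_padicSigma_eq W p h5 hord
  unfold WeierstrassCurve.padicSigmaEval
  rw [← hsum.sum_add_tsum_nat_add 3]
  simp only [Finset.sum_range_succ, Finset.sum_range_zero, zero_add,
    WeierstrassCurve.coeff_zero_padicSigma, WeierstrassCurve.coeff_one_padicSigma, hc2]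
  ring

/-- **Stub `stub_sigmaJet` of line `wieferich-jet` (crux `PAdicOrderThesisR2`, stmt-0487): the
`t³`-jet of the Mazur–Tate sigma function.** For `E/ℚ` with globally minimal model `W`, a prime
`p ≥ 5` of good ordinary reduction and `t ∈ ℚ_p` with `‖t‖ < 1`:
`‖σ_p(t) − t − (a₁/2) t²‖ ≤ ‖t‖³`. The canonical sigma function is
`σ_p(t) = t + (a₁/2)t² + Σ_{n ≥ 3} cₙ tⁿ` with `cₙ ∈ ℤ_p` (Mazur–Stein–Tate 2006, Thm. 1.3 and
Rem. 1.4; tree: `mazur_tate_sigma_existsUnique_holds`, `IsMazurTateSigmaPair.two_mul_coeff_two`,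
`norm_coeff_padicSigma_le`), so the difference is the tail `Σ_{n ≥ 3} cₙ tⁿ`
(`padicSigmaEval_sub_sub_eq_tsum`), each term of norm `≤ ‖t‖ⁿ ≤ ‖t‖³`, and the ultrametric
inequality for `tsum` bounds the sum by `‖t‖³`. [cite: MazurSteinTate2006, Thm. 1.3] -/
theorem stub_sigmaJet :
    ∀ (W : WeierstrassCurve ℚ) [W.IsElliptic] [W.IsGloballyMinimal] (p : ℕ) [Fact p.Prime],
      5 ≤ p → IsOrdinaryAt W p → ∀ (t : ℚ_[p]), ‖t‖ < 1 →
        ‖W.padicSigmaEval p t - t - (W.a₁ : ℚ_[p]) / 2 * t ^ 2‖ ≤ ‖t‖ ^ 3 := by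
  intro W _ _ p _ h5 hord t ht
  rw [padicSigmaEval_sub_sub_eq_tsum W p h5 hord t ht]
  refine IsUltrametricDist.norm_tsum_le_of_forall_le_of_nonneg (by positivity) fun n => ?_
  rw [norm_mul, norm_pow]
  calc ‖PowerSeries.coeff (n + 3) (W.baseChange ℚ_[p]).padicSigma‖ * ‖t‖ ^ (n + 3)
      ≤ 1 * ‖t‖ ^ (n + 3) := by
        gcongr
        exact WeierstrassCurve.norm_coeff_padicSigma_le _ _
    _ ≤ ‖t‖ ^ 3 := by
        rw [one_mul]
        exact pow_le_pow_of_le_one (norm_nonneg t) ht.le (by omega)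

end Summit.BirchSwinnertonDyer.BirchSwinnertonDyer.Cruxes.PAdicOrderThesisR2.WieferichJet
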